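import Summits.CriticalPhenomena.CardyFormulaZ2.Theses.CardyExpCovariance
import Summits.CriticalPhenomena.CardyFormulaZ2.Theorems.CardyViaSLE6Assembly
import Summits.CriticalPhenomena.CardyFormulaZ2.Theorems.CardySelfRefinementLagHandOffDiscretisable
import Literature.Probability.Percolation.BondInterfaceMeasurability
import Literature.Probability.RandomPlanarGeometry.ChordalCurveFamily
import Literature.Probability.RandomPlanarGeometry.SLEUniquenessInLaw
import Literature.Probability.RandomPlanarGeometry.LocalMartingaleProofs

/-!
# Birth skeleton (BC3) for piece X₂ `SeqCrossingReadout` of the split of `CardyRigiditySeq` (stmt-CriticalPhenomena-4680)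

Route `CardyExpCovariance`; the piece is a child of the crux `CardyRigiditySeq` in the
strategist's children.json (restated verbatim here, the route decl does not exist yet).

    SeqCrossingReadout := ∀ u f κ, 0 < κ → u_k → 0⁺ → HYPSEQ u f → LIMSEQ κ u →
      ∀ R μ φ x, IsSLELaw κ (R.chord 0 2) μ → R.IsUniformizing φ x →
        μ.real (hitsBefore (R.arc 2) (R.arc 1)) = f (crossRatio x)

"the sequential crossing kernel IS the crossing law of the limiting SLE_κ".  The line: the
percolation content is EXACTLY the lattice crossing/interface dictionary already filed (and shared)
on route `CardyViaSLE6` — `InterfaceImpliesCrossing` (stmt-CriticalPhenomena-11317) and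
`CrossingImpliesInterface` (stmt-11318), used here BY NAME as hypotheses of the composition — plus
two regularity lemmas for hitting events that hold for every SLE_κ law (indeed for every finite
Borel measure carried by curves from `a ∉ (bc)` to `c ∈ (bc)`):

* `stub_hitsBeforeUpperApprox` (size M; any finite measure): `μ(hits (cd) before (bc)) ≤
  μ(U(a,b)) + ε` for `b < b₀(ε)` and every `a > 0`, `U(a,b)` = "a-close to `(cd)` at a time up to
  which the curve stayed `> b` away from `(bc)`" (open) — the events
  `{hit (cd) at t, dist(γ[0,t], (bc)) > b}` increase to `hitsBefore` as `b ↓ 0`.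
* `stub_sleTargetSideApprox` (size M/L; any `κ > 0`): `μ(univ) ≤ μ(V(b,b')) + μ(hits (cd) before
  (bc)) + ε` for every `b > 0` and `b' < b₀'(ε, b)`, `V(b,b')` = "b-close to `(bc)` at a time up to
  which the curve stayed `> b'` away from `(cd)`": a curve from `a ∉ (bc)` to `c ∈ (bc)` that is not
  in `⋃_{b'} V(b,b')` touches `(cd)` no later than it first comes `b`-close to `(bc)`, hence strictly
  before it touches `(bc)` — so it is in `hitsBefore` (deterministic curve topology + continuity of
  finite measures; the SLE input is only `γ(0) = a`, `γ(1) = c` a.s.).  Unlike the `κ > 4` sandwich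
  `SLE6HittingSandwich` (stmt-8608) the quantifiers are `∀ b ∃ b₀'`, which holds for ALL `κ > 0` and
  still suffices.

Composition `SeqCrossingReadout_of` (real proof, the measure theory done HERE): an admissible
family `E` of `R.chord 0 2` exists (landed `stub_discretisable`); `LIMSEQ` gives the limit SLE_κ
curve `Γ`, whose law is `μ` by uniqueness of the SLE_κ law (`IsSLELaw.unique`,
`IsSLECurve.map_eq_holds`); the OPEN-SET PORTMANTEAU ALONG `u`
(`eventually_lt_measureReal_preimage_of_tendsto_atTop`, from Mathlib's
`ProbabilityMeasure.le_liminf_measure_open_of_tendsto`) bounds `P(γ_k ∈ U)`, `P(γ_k ∈ V)` below by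
`μ U - ε`, `μ V - ε` eventually; `U ∩ V = ∅` (`disjoint_image_hitsBeforeApprox`, landed); the
dictionary ties `P(γ_k ∈ U)` to `P_0.5(R, u_k)` within `ε`, and `HYPSEQ` ties the latter to
`f (crossRatio x)`; so `|μ(hitsBefore) - f(crossRatio x)| < 4ε` for every `ε`, i.e. equality.
-/

noncomputable section

namespace Summit.CriticalPhenomena.CardyFormulaZ2.Cruxes.CardyRigiditySeq.BirthSeqCrossingReadout

open scoped NNReal Topology ENNReal
open MeasureTheory Filter Set Metric
open Literature.Probability.RandomPlanarGeometry Literature.Probability.LatticeModels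
open Literature.Probability.Percolation (bondPercolation half BondConfig measurable_bondInterfaceIn
  bondDomainCrossingProb)
open Summit.CriticalPhenomena.CardyFormulaZ2.Theses.CardyViaSLE6 (InterfaceImpliesCrossing
  CrossingImpliesInterface)
open Summit.CriticalPhenomena.CardyFormulaZ2.Theorems.CardyViaSLE6 (disjoint_image_hitsBeforeApprox)

/-- Piece X₂ of the split of `CardyRigiditySeq`, restated VERBATIM from the strategist's
children.json. -/
def SeqCrossingReadout : Prop :=
  ∀ (u : ℕ → ℝ) (f : ℝ → ℝ) (κ : NNReal), 0 < κ → Filter.Tendsto u Filter.atTop (nhdsWithin 0 (Set.Ioi 0)) → (∀ (R : Literature.Probability.RandomPlanarGeometry.ConformalRectangle) (φ : Literature.Probability.RandomPlanarGeometry.ConformalEquiv UpperHalfPlane.upperHalfPlaneSet R.carrier) (x : Fin 4 → ℝ), R.IsUniformizing φ x → Filter.Tendsto (fun k ↦ Literature.Probability.Percolation.bondDomainCrossingProb R (u k)) Filter.atTop (nhds (f (Literature.Probability.RandomPlanarGeometry.crossRatio x)))) → (∀ (D : Literature.Probability.RandomPlanarGeometry.DobrushinDomain) (E : ℝ → Literature.Probability.LatticeModels.DiscreteDobrushin),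 Literature.Probability.LatticeModels.ZdDiscretisationFamily D E → ∃ Γ : (NNReal → ℝ) → Literature.Probability.RandomPlanarGeometry.CurveClass ℂ, Literature.Probability.RandomPlanarGeometry.IsSLECurve κ D Γ ∧ ∀ g : BoundedContinuousFunction (Literature.Probability.RandomPlanarGeometry.CurveClass ℂ) ℝ, Filter.Tendsto (fun k ↦ ∫ ω, g (Literature.Probability.Percolation.bondInterfaceIn D (E (u k)) ω) ∂(Literature.Probability.Percolation.bondPercolation (Literature.Probability.LatticeModels.zdGraph 2) Literature.Probability.Percolation.half)) Filter.atTop (nhds (∫ ω, g (Γ ω) ∂Literature.Probability.Process.preWienerMeasure))) → ∀ (R : Literature.Probability.RandomPlanarGeometry.ConformalRectangle) (μ : MeasureTheory.Measure (Literature.Probability.RandomPlanarGeometry.CurveClass ℂ)) (φ : Literature.Probability.RandomPlanarGeometry.ConformalEquiv UpperHalfPlane.upperHalfPlaneSet R.carrier) (x : Fin 4 → ℝ), Literature.Probability.RandomPlanarGeometry.IsSLELaw κ (R.chord 0 2 (by decide)) μ → R.IsUniformizing φ x → μ.real (Literature.Probability.RandomPlanarGeometry.CurveClass.hitsBefore (R.arc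 2) (R.arc 1)) = f (Literature.Probability.RandomPlanarGeometry.crossRatio x)

/-- STUB U — **upper approximation of the crossing event by the open events `U(a,b)`** (any finite
Borel measure on curve classes; size M). -/
protected theorem Holds.stub_hitsBeforeUpperApprox :
    ∀ (R : Literature.Probability.RandomPlanarGeometry.ConformalRectangle) (μ : MeasureTheory.Measure (Literature.Probability.RandomPlanarGeometry.CurveClass ℂ)), MeasureTheory.IsFiniteMeasure μ → ∀ ε > (0:ℝ), ∃ b₀ > (0:ℝ), ∀ b ∈ Set.Ioo 0 b₀, ∀ a > (0:ℝ), μ.real (Literature.Probability.RandomPlanarGeometry.CurveClass.hitsBefore (R.arc 2) (R.arc 1)) ≤ μ.real (Literature.Probability.RandomPlanarGeometry.CurveClass.mk '' Literature.Probability.RandomPlanarGeometry.CurveClass.hitsBeforeApprox (R.arc 2) (R.arc 1) a b) + ε := by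
  sorry

/-- By-name handle of the registered stub `Holds.stub_hitsBeforeUpperApprox`. -/
def stub_hitsBeforeUpperApprox : Prop := type_of% Holds.stub_hitsBeforeUpperApprox

/-- STUB V — **target-side approximation** for every SLE_κ law, `κ > 0` (curve from `a ∉ (bc)` to
`c ∈ (bc)`; size M/L). -/
protected theorem Holds.stub_sleTargetSideApprox :
    ∀ (κ : NNReal), 0 < κ → ∀ (R : Literature.Probability.RandomPlanarGeometry.ConformalRectangle) (μ : MeasureTheory.Measure (Literature.Probability.RandomPlanarGeometry.CurveClass ℂ)), Literature.Probability.RandomPlanarGeometry.IsSLELaw κ (R.chord 0 2 (by decide)) μ → ∀ ε > (0:ℝ), ∀ b > (0:ℝ), ∃ b₀' > (0:ℝ), ∀ b' ∈ Set.Ioo 0 b₀', μ.real Set.univ ≤ μ.real (Literature.Probability.RandomPlanarGeometry.CurveClass.mk '' Literature.Probability.RandomPlanarGeometry.CurveClass.hitsBeforeApprox (R.arc 1) (R.arc 2) b b') + μ.real (Literature.Probability.RandomPlanarGeometry.CurveClass.hitsBefore (R.arc 2) (R.arc 1)) + ε := by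
  sorry

/-- By-name handle of the registered stub `Holds.stub_sleTargetSideApprox`. -/
def stub_sleTargetSideApprox : Prop := type_of% Holds.stub_sleTargetSideApprox

/-! ### Open-set portmanteau along a sequence -/

/-- **Open-set portmanteau along `atTop`**: if `Y k → Z` in law (bounded continuous test functions)
with `Y k` a.e.-measurable and `Z` a.e.-measurable, then for every open `G` and `ε > 0`,
eventually `Law(Z)(G) - ε < P(Y k ∈ G)` (Billingsley 1999, Thm 2.1; Mathlib's
`ProbabilityMeasure.le_liminf_measure_open_of_tendsto`). -/
theorem eventually_lt_measureReal_preimage_of_tendsto_atTop {Ω Ω' X : Type*} [MeasurableSpace Ω]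
    [MeasurableSpace Ω'] [PseudoEMetricSpace X] [MeasurableSpace X] [BorelSpace X]
    {P : Measure Ω} [IsProbabilityMeasure P] {W : Measure Ω'} [IsProbabilityMeasure W]
    {Y : ℕ → Ω → X} {Z : Ω' → X} (hZ : AEMeasurable Z W) (hY : ∀ k, AEMeasurable (Y k) P)
    (hlaw : ∀ g : BoundedContinuousFunction X ℝ,
      Tendsto (fun k ↦ ∫ ω, g (Y k ω) ∂P) atTop (𝓝 (∫ ω, g (Z ω) ∂W)))
    {G : Set X} (hG : IsOpen G) {ε : ℝ} (hε : 0 < ε) :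
    ∀ᶠ k in atTop, (W.map Z).real G - ε < P.real (Y k ⁻¹' G) := by
  have htd : Tendsto (β := ProbabilityMeasure X)
      (fun k ↦ ⟨P.map (Y k), Measure.isProbabilityMeasure_map (hY k)⟩) atTop
      (𝓝 ⟨W.map Z, Measure.isProbabilityMeasure_map hZ⟩) := by
    rw [ProbabilityMeasure.tendsto_iff_forall_integral_tendsto]
    intro g
    simp only [ProbabilityMeasure.coe_mk]
    rw [integral_map hZ g.continuous.aestronglyMeasurable]
    simp_rw [integral_map (hY _) g.continuous.aestronglyMeasurable]
    exact hlaw g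
  have hli := ProbabilityMeasure.le_liminf_measure_open_of_tendsto htd hG
  simp only [ProbabilityMeasure.coe_mk] at hli
  set m : ℝ≥0∞ := W.map Z G with hm
  haveI : IsProbabilityMeasure (W.map Z) := Measure.isProbabilityMeasure_map hZ
  have hm_top : m ≠ ∞ := measure_ne_top _ _
  by_cases hm0 : m.toReal - ε < 0
  · filter_upwards with k
    rw [measureReal_def]
    exact hm0.trans_le ENNReal.toReal_nonneg
  · rw [not_lt] at hm0
    have hmpos : m ≠ 0 := by
      intro h
      rw [h, ENNReal.toReal_zero] at hm0
      linarith
    have hlt : m - ENNReal.ofReal ε < m :=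
      ENNReal.sub_lt_self hm_top hmpos (by simpa using hε)
    have hev : ∀ᶠ k in atTop, m - ENNReal.ofReal ε < P.map (Y k) G :=
      Filter.eventually_lt_of_lt_liminf (hlt.trans_le hli)
    filter_upwards [hev] with k hk
    haveI : IsProbabilityMeasure (P.map (Y k)) := Measure.isProbabilityMeasure_map (hY k)
    have h1 : (m - ENNReal.ofReal ε).toReal < (P.map (Y k) G).toReal :=
      (ENNReal.toReal_lt_toReal (ne_top_of_le_ne_top hm_top tsub_le_self) (measure_ne_top _ _)).2 hk
    have h2 : m.toReal - ε ≤ (m - ENNReal.ofReal ε).toReal := by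
      have := ENNReal.le_toReal_sub (a := m) (b := ENNReal.ofReal ε) ENNReal.ofReal_ne_top
      rwa [ENNReal.toReal_ofReal hε.le] at this
    have h3 : P.map (Y k) G = P (Y k ⁻¹' G) := by
      rw [Measure.map_apply_of_aemeasurable (hY k) hG.measurableSet]
    rw [measureReal_def, measureReal_def, ← h3]
    exact h2.trans_lt h1

/-! ### The composition -/

/-- **Composition (real proof):** the shared lattice dictionary of route `CardyViaSLE6`
(`InterfaceImpliesCrossing`, `CrossingImpliesInterface`, existing items by name) and the two
registered stubs imply the piece `SeqCrossingReadout` BY NAME. -/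
theorem SeqCrossingReadout_of :
    InterfaceImpliesCrossing → CrossingImpliesInterface →
      stub_hitsBeforeUpperApprox → stub_sleTargetSideApprox → SeqCrossingReadout := by
  intro h3 h4 hU hV
  dsimp only [stub_hitsBeforeUpperApprox, stub_sleTargetSideApprox] at hU hV
  intro u f κ hκ hu hf hlim R μ φ x hμ hφ
  classical
  haveI hWprob : IsProbabilityMeasure Literature.Probability.Process.preWienerMeasure :=
    isProbabilityMeasure_preWienerMeasure'
  -- an admissible family of `R.chord 0 2`, its limit SLE_κ curve `Γ`, whose law is `μ`
  obtain ⟨E, hE⟩ :=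
    Summit.CriticalPhenomena.CardyFormulaZ2.Cruxes.LagHandOff.HittingTournament.stub_discretisable
      (R.chord 0 2 (by decide))
  obtain ⟨Γ, hΓ, hconv⟩ := hlim _ E hE
  have hμΓ : μ = Literature.Probability.Process.preWienerMeasure.map Γ :=
    IsSLELaw.unique IsSLECurve.map_eq_holds hμ hΓ.isSLELaw_map
  haveI : IsProbabilityMeasure μ := by
    rw [hμΓ]; exact Measure.isProbabilityMeasure_map hΓ.aemeasurable
  set P : Measure (BondConfig (Site 2)) := bondPercolation (zdGraph 2) half with hP
  set c : ℝ := μ.real (CurveClass.hitsBefore (R.arc 2) (R.arc 1)) with hc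
  set t : ℝ := f (crossRatio x) with ht
  -- the crossing probabilities along `u` tend to `t`
  have hp : Tendsto (fun k ↦ bondDomainCrossingProb R (u k)) atTop (𝓝 t) := hf R φ x hφ
  refine eq_of_forall_dist_le fun e he ↦ ?_
  obtain ⟨ε, hε, hεe⟩ : ∃ ε : ℝ, 0 < ε ∧ 4 * ε ≤ e := ⟨e / 4, by positivity, by linarith⟩
  -- parameters: b from the upper approximation and the lower dictionary, b' from the target-side
  -- approximation, a from the upper dictionary with a ≤ b'
  obtain ⟨b₂, hb₂, hU'⟩ := hU R μ inferInstance ε hε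
  obtain ⟨a₀, ha₀, h3'⟩ := h3 R E hE ε hε
  obtain ⟨b₀, hb₀, h4'⟩ := h4 R E hE ε hε
  obtain ⟨b, hb, hbb₂, hbb₀⟩ : ∃ b : ℝ, 0 < b ∧ b < b₂ ∧ b < b₀ :=
    ⟨min b₂ b₀ / 2, by positivity, by linarith [min_le_left b₂ b₀], by linarith [min_le_right b₂ b₀]⟩
  obtain ⟨b₁, hb₁, hV'⟩ := hV κ hκ R μ hμ ε hε b hb
  obtain ⟨b', hb', hb'b₁⟩ : ∃ b' : ℝ, 0 < b' ∧ b' < b₁ := ⟨b₁ / 2, by positivity, by linarith⟩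
  obtain ⟨a, ha, haa₀, hab'⟩ : ∃ a : ℝ, 0 < a ∧ a < a₀ ∧ a ≤ b' :=
    ⟨min (a₀ / 2) b', by positivity, by linarith [min_le_left (a₀ / 2) b'], min_le_right _ _⟩
  -- the two open events
  set U : Set (CurveClass ℂ) :=
    CurveClass.mk '' CurveClass.hitsBeforeApprox (R.arc 2) (R.arc 1) a b with hUdef
  set V : Set (CurveClass ℂ) :=
    CurveClass.mk '' CurveClass.hitsBeforeApprox (R.arc 1) (R.arc 2) b b' with hVdef
  have hUo : IsOpen U :=
    SeparationQuotient.isOpenMap_mk _ (CurveClass.isOpen_hitsBeforeApprox _ _ _ _)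
  have hVo : IsOpen V :=
    SeparationQuotient.isOpenMap_mk _ (CurveClass.isOpen_hitsBeforeApprox _ _ _ _)
  have hUV : Disjoint U V := disjoint_image_hitsBeforeApprox hab' le_rfl
  -- the two approximations under `μ`
  have eS1 : c ≤ μ.real U + ε := hU' b ⟨hb, hbb₂⟩ a ha
  have eS2 : μ.real univ ≤ μ.real V + c + ε := hV' b' ⟨hb', hb'b₁⟩
  have huniv : μ.real univ = 1 := probReal_univ
  -- the interfaces along `u`
  set X : ℕ → BondConfig (Site 2) → CurveClass ℂ := fun k ↦
    Literature.Probability.Percolation.bondInterfaceIn (R.chord 0 2 (by decide)) (E (u k)) with hXdef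
  have hXm : ∀ k, AEMeasurable (X k) P := fun k ↦ (measurable_bondInterfaceIn _ _).aemeasurable
  have hconv' : ∀ g : BoundedContinuousFunction (CurveClass ℂ) ℝ,
      Tendsto (fun k ↦ ∫ ω, g (X k ω) ∂P) atTop
        (𝓝 (∫ ω, g (Γ ω) ∂Literature.Probability.Process.preWienerMeasure)) := hconv
  -- portmanteau for the two open events (laws of `Γ` = `μ`)
  have hpU := eventually_lt_measureReal_preimage_of_tendsto_atTop hΓ.aemeasurable hXm hconv' hUo hε
  have hpV := eventually_lt_measureReal_preimage_of_tendsto_atTop hΓ.aemeasurable hXm hconv' hVo hε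
  rw [← hμΓ] at hpU hpV
  -- the lattice dictionary, eventually along `u`
  have h3e := hu.eventually (h3' a ⟨ha, haa₀⟩ b hb)
  have h4e := hu.eventually (h4' b ⟨hb, hbb₀⟩ a ha)
  -- the crossing probabilities are eventually `ε`-close to `t`
  have hpe : ∀ᶠ k in atTop, dist (bondDomainCrossingProb R (u k)) t < ε :=
    Metric.tendsto_nhds.1 hp ε hε
  obtain ⟨k, hk⟩ := (h3e.and (h4e.and (hpU.and (hpV.and hpe)))).exists
  obtain ⟨hk3, hk4, hkU, hkV, hkp⟩ := hk
  -- restate at this `k`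
  have e3 : P.real (X k ⁻¹' U) ≤ bondDomainCrossingProb R (u k) + ε := hk3
  have e4 : bondDomainCrossingProb R (u k) ≤ P.real (X k ⁻¹' U) + ε := hk4
  have eU : μ.real U - ε < P.real (X k ⁻¹' U) := hkU
  have eV : μ.real V - ε < P.real (X k ⁻¹' V) := hkV
  have ep : dist (bondDomainCrossingProb R (u k)) t < ε := hkp
  rw [Real.dist_eq, abs_sub_lt_iff] at ep
  -- disjointness in probability
  have hsum : P.real (X k ⁻¹' U) + P.real (X k ⁻¹' V) ≤ 1 := by
    have hAB : P (X k ⁻¹' U) + P (X k ⁻¹' V) ≤ 1 := by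
      rw [← measure_union₀ ((hXm k).nullMeasurableSet_preimage hVo.measurableSet)
        (hUV.preimage _).aedisjoint]
      exact prob_le_one
    rw [measureReal_def, measureReal_def,
      ← ENNReal.toReal_add (measure_ne_top _ _) (measure_ne_top _ _)]
    calc _ ≤ (1 : ℝ≥0∞).toReal := ENNReal.toReal_mono ENNReal.one_ne_top hAB
      _ = 1 := by simp
  rw [Real.dist_eq]
  refine le_trans (le_of_lt ?_) hεe
  rw [abs_sub_lt_iff]
  constructor <;> linarith

/-- The piece, conditionally on the two shared dictionary items and the two registered stubs. -/
theorem seqCrossingReadout_of_items_and_stubs (h3 : InterfaceImpliesCrossing)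
    (h4 : CrossingImpliesInterface) : SeqCrossingReadout :=
  SeqCrossingReadout_of h3 h4 Holds.stub_hitsBeforeUpperApprox Holds.stub_sleTargetSideApprox

end Summit.CriticalPhenomena.CardyFormulaZ2.Cruxes.CardyRigiditySeq.BirthSeqCrossingReadout

end
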